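import Summits.ResolutionOfSingularities.ResolutionOfSingularities.Theorems.SyzygyFlatteningDefs
import Summits.ResolutionOfSingularities.ResolutionOfSingularities.Theorems.SyzygyFlatteningHigherRankTerminationExistsMinimalDatum
import Literature.AlgebraicGeometry.Resolution.ModuleBlowup
import Literature.AlgebraicGeometry.Resolution.SyzygySheaf
import Literature.AlgebraicGeometry.Resolution.ProperModels
import HarnessLib

/-!
# A syzygy norm ideal datum exists on every non-empty affine open — `stub_syzygyDatumExists`

Crux `SyzygyFlattening.Globalisation` (stmt-ResolutionOfSingularities-17061), line `birth`,
registered stub `stub_syzygyDatumExists`. For a proper model `M` of `K/k` and a non-empty affine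
open `U ⊆ M`, the ring `R = Γ(M, U)` is a noetherian domain; let `J ⊆ R` be the ideal of the
non-regular locus (`sInf {𝔭 : R_𝔭 not regular}`, verbatim the route's `J`) and
`e = syzygyIndex k K - 1` the route's index. A **syzygy norm ideal datum** for `(R, e, J)` is a
finite free resolution `F` of `R ⧸ J` (`FreeResolution`, `SyzygySheaf.lean`), an injective
framing `φ : F.syzygy e → R^r` (`IsFraming`, `ModuleBlowup.lean`) and the ideal of maximal minors
`N = normIdeal φ` (Villamayor's norm `[[Ω]]` of the syzygy module `Ω = F.syzygy e` of generic
rank `r`, realised through the inclusion `Ω/tor ⊂ R^r`, Villamayor 2006, 3.4). The stub: such a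
datum exists and `N ≠ ⊥`.

Proof (pattern `exists_minimalDatum_of_isNoetherianRing`,
`…HigherRankTerminationExistsMinimalDatum.lean`; every ingredient is in the tree):
* `exists_syzygyDatum_of_isNoetherianRing` — over a noetherian domain `A`, for a finite module
  `N` and any index `m`: `F = FreeResolution.ofNoetherian N`; the syzygy module `F.syzygy m` is
  a finite submodule of `A^{rank m}`, of generic rank `r = finrank` (`Module.finrank_eq_rank`);
  `exists_isFraming` gives a framing `φ : F.syzygy m → A^r`, injective because `A^{rank m}` is
  torsion-free (`injective_of_isFraming_submodule_pi`), and `normIdeal φ ≠ ⊥`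
  (`IsFraming.normIdeal_ne_bot`);
* `stub_syzygyDatumExists` — specialise to `A = Γ(M, U)` (noetherian:
  `IsLocallyNoetherian.component_noetherian`; a domain: `IsIntegral.component_integral`, `U`
  being non-empty) and the cyclic module `N = Γ(M, U) ⧸ J`.
-/

noncomputable section

-- single-problem summit: the doubled namespace component `ResolutionOfSingularities` is forced
set_option linter.dupNamespace false

namespace Summit.ResolutionOfSingularities.ResolutionOfSingularities.Theorems.SyzygyFlattening

open CategoryTheory AlgebraicGeometry TopologicalSpace
open Literature.AlgebraicGeometry
open Literature.AlgebraicGeometry.Resolution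

/-- **Syzygy norm ideal data exist over a noetherian domain.** For a finite module `N` over a
noetherian domain `A` and any `m : ℕ` there are a free resolution of finite type `F` of `N`
(`FreeResolution.ofNoetherian`), an injective framing `φ : F.syzygy m → A^r` of its syzygy
module in degree `m` (`exists_isFraming` at `r = finrank (F.syzygy m)`; injective since
`F.syzygy m ⊆ A^{rank m}` is torsion-free) and its norm ideal `normIdeal φ ≠ ⊥`
(`IsFraming.normIdeal_ne_bot`). [cite: Villamayoru2006, 3.4] -/
theorem exists_syzygyDatum_of_isNoetherianRing {A : Type*} [CommRing A] [IsDomain A]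
    [IsNoetherianRing A] (N : Type*) [AddCommGroup N] [Module A N] [Module.Finite A N] (m : ℕ) :
    ∃ I : Ideal A, I ≠ ⊥ ∧ ∃ (F : FreeResolution A N) (r : ℕ)
      (φ : ↥(F.syzygy m) →ₗ[A] (Fin r → A)),
      Function.Injective φ ∧ IsFraming φ ∧ I = normIdeal φ := by
  let F : FreeResolution A N := FreeResolution.ofNoetherian (R := A) N
  -- the generic rank of the (finite) syzygy module `F.syzygy m ⊆ A^{rank m}` is a natural number
  obtain ⟨r, hr⟩ : ∃ r : ℕ, Module.rank A ↥(F.syzygy m) = r :=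
    ⟨_, (Module.finrank_eq_rank A _).symm⟩
  obtain ⟨φ, hφ⟩ := exists_isFraming hr
  exact ⟨normIdeal φ, hφ.normIdeal_ne_bot, F, r, φ, injective_of_isFraming_submodule_pi _ hφ,
    hφ, rfl⟩

/-- **Syzygy norm ideal data for a quotient ring `A ⧸ J`** (the case of the route: the resolved
module is `Γ(M, U) ⧸ J`, `J` the ideal of the non-regular locus, a cyclic hence finite module).
[cite: Villamayoru2006, 3.4] -/
theorem exists_syzygyDatum_quotient {A : Type*} [CommRing A] [IsDomain A] [IsNoetherianRing A]
    (J : Ideal A) (m : ℕ) :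
    ∃ I : Ideal A, I ≠ ⊥ ∧ ∃ (F : FreeResolution A (A ⧸ J)) (r : ℕ)
      (φ : ↥(F.syzygy m) →ₗ[A] (Fin r → A)),
      Function.Injective φ ∧ IsFraming φ ∧ I = normIdeal φ :=
  exists_syzygyDatum_of_isNoetherianRing (A ⧸ J) m

/-- **STUB `stub_syzygyDatumExists`** (crux stmt-ResolutionOfSingularities-17061, line `birth`).
On a non-empty affine open `U` of a proper model `M` of `K/k`, a syzygy norm ideal datum for
`Γ(M, U)` at the route's index `e = syzygyIndex k K - 1` and the ideal `J` of the non-regular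
locus exists, with non-zero norm ideal: `Γ(M, U)` is a noetherian domain
(`IsLocallyNoetherian.component_noetherian`, `IsIntegral.component_integral`), `Γ(M, U) ⧸ J`
has a finite free resolution (`FreeResolution.ofNoetherian`), its `e`-th syzygy module (a
submodule of a free module) has a framing (`exists_isFraming`), injective by torsion-freeness,
and `normIdeal φ ≠ ⊥` (`IsFraming.normIdeal_ne_bot`) — `exists_syzygyDatum_quotient`.
[cite: Villamayoru2006, 3.4] -/
theorem stub_syzygyDatumExists : ∀ (k K : Type) [Field k] [Field K] [Algebra k K]
    (M : ProperModel k K) (U : M.X.Opens) (_hU : IsAffineOpen U), ((U : Set M.X).Nonempty) →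
      ∃ N : Ideal Γ(M.X, U), N ≠ ⊥ ∧
        ∃ (F : FreeResolution Γ(M.X, U) (Γ(M.X, U) ⧸
            sInf ((fun 𝔭 : PrimeSpectrum Γ(M.X, U) => 𝔭.asIdeal) ''
              {𝔭 : PrimeSpectrum Γ(M.X, U) | ¬ IsRegularLocalRing (Localization.AtPrime 𝔭.asIdeal)})))
          (r : ℕ) (φ : ↥(F.syzygy (syzygyIndex k K - 1)) →ₗ[Γ(M.X, U)] (Fin r → Γ(M.X, U))),
          Function.Injective φ ∧ IsFraming φ ∧ N = normIdeal φ := by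
  intro k K _ _ _ M U hU hne
  haveI : IsNoetherianRing Γ(M.X, U) := IsLocallyNoetherian.component_noetherian ⟨U, hU⟩
  haveI : Nonempty U := ⟨⟨_, hne.some_mem⟩⟩
  haveI : IsDomain Γ(M.X, U) := IsIntegral.component_integral U
  exact exists_syzygyDatum_quotient _ _

end Summit.ResolutionOfSingularities.ResolutionOfSingularities.Theorems.SyzygyFlattening

end
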